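import Summits.QuantumAdvantage.QuantumAdvantage.Theorems.StabilizerDialGaugeA

/-! # StabilizerDialGauge — part 2/2 (mechanical split for landing of `StabilizerDialGauge`; content verbatim; scopes re-opened with their variables) -/

set_option linter.dupNamespace false
noncomputable section
open scoped Classical

namespace Summit.QuantumAdvantage.QuantumAdvantage.Theorems.StabilizerDial
open Finset
open Literature.Computability.QuantumComplexity Literature.Computability.QuantumComplexity.RingHLF
open Literature.Computability.MetaComplexity Literature.Computability.MetaComplexity.Smolensky
open Summit.QuantumAdvantage.AdviceFreeQNC0
open Summit.QuantumAdvantage.QuantumAdvantage.Theses (ExactnessDial.PolyLossOddU3 ExactnessDial.DPLift3)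
open Summit.QuantumAdvantage.QuantumAdvantage.Theorems.HolonomyDial (gCond selP selP_mem selP_apply xorP xorP_mem
  xorP_apply_bool tPoly tPoly_mem tPoly_apply mono_singleton_apply closes_T card_odd_le)
open Summit.QuantumAdvantage.QuantumAdvantage.Theorems.AnchorDial (outB dev win_iff loss_shape_mono card_odd_ge)
open Summit.QuantumAdvantage.QuantumAdvantage.Theorems.LocusDial (Coverable FewLocus FewLocusLoss3 ManyLocusLoss3
  fewLocusLoss3_of_polyLossOddU3 manyLocusLoss3_of_polyLossOddU3 Coverable.card_le coverable_empty dev_tPoly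
  fewLocus_tPoly acStrat dev_acStrat not_fewLocus_acStrat)
variable {N : ℕ}

/-- **POINTWISE EXCLUSION**: for `N ≥ 4m(r+1) + 8`, on NO input are `dev P x` and `dev (pad P comb) x` both
`(m, r)`-coverable. -/
theorem not_both_coverable {m r : ℕ} (hN : 4 * (m * (r + 1)) + 8 ≤ N) (P : Fin N → CubeFn (ZMod 3) N)
    (x : Fin N → Bool) (h1 : Coverable m r (dev P x)) (h2 : Coverable m r (dev (pad P comb) x)) : False := by
  have hsub : (teeth : Finset (Fin N)) ⊆ dev P x ∪ dev (pad P comb) x := by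
    intro j hj
    rw [Finset.mem_union, dev_pad, Finset.mem_symmDiff]
    have hw : j ∈ rowSet comb x := by simp [rowSet, rowMask_comb_of_teeth hj]
    by_cases hd : j ∈ dev P x
    · exact Or.inl hd
    · exact Or.inr (Or.inr ⟨hw, hd⟩)
  have hK := le_card_teeth (N := N) (2 * (m * (r + 1)) + 1) (by omega)
  have hc := (Finset.card_le_card hsub).trans (Finset.card_union_le _ _)
  have c1 := h1.card_le
  have c2 := h2.card_le
  omega

/-- StabilizerDialGauge helper `three_le_log` (decomp-qadv land package; see the module docstring). -/
theorem three_le_log (hN : 8 ≤ N) : 3 ≤ Nat.log 2 N :=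
  Nat.le_log_of_pow_le (by norm_num) (by norm_num; omega)

/-- **COUNTING**: for `N ≥ 8` and `N ≥ 4m(r+1) + 8`, `P` and `pad P comb` are not BOTH few-locus at `(m, r)`. -/
theorem not_fewLocus_both {m r : ℕ} (hN8 : 8 ≤ N) (hN : 4 * (m * (r + 1)) + 8 ≤ N)
    (P : Fin N → CubeFn (ZMod 3) N) (h1 : FewLocus m r P) (h2 : FewLocus m r (pad P comb)) : False := by
  unfold FewLocus at h1 h2
  set A := univ.filter fun x : Fin N → Bool => OddZeros x ∧ ¬ Coverable m r (dev P x)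
  set B := univ.filter fun x : Fin N → Bool => OddZeros x ∧ ¬ Coverable m r (dev (pad P comb) x)
  have hO : (univ.filter fun x : Fin N → Bool => OddZeros x) ⊆ A ∪ B := by
    intro x hx
    simp only [mem_filter, mem_univ, true_and] at hx
    simp only [A, B, mem_union, mem_filter, mem_univ, true_and]
    by_cases hc : Coverable m r (dev P x)
    · exact Or.inr ⟨hx, fun hc' => not_both_coverable hN P x hc hc'⟩
    · exact Or.inl ⟨hx, hc⟩
  have hcard := (Finset.card_le_card hO).trans (Finset.card_union_le A B)
  have hodd := card_odd_ge (N := N) (by omega)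
  have hlog := three_le_log hN8
  have h3 : 3 * 2 ^ (N - 1) ≤ Nat.log 2 N * (A.card + B.card) := Nat.mul_le_mul hlog (hodd.trans hcard)
  have h4 : Nat.log 2 N * (A.card + B.card) ≤ 2 ^ (N - 1) + 2 ^ (N - 1) := by
    rw [mul_add]; exact add_le_add h1 h2
  have hpos : 1 ≤ 2 ^ (N - 1) := Nat.one_le_two_pow
  omega

/-- StabilizerDialGauge helper `deg_pad_comb` (decomp-qadv land package; see the module docstring). -/
theorem deg_pad_comb (n c : ℕ) (hn : 8 ≤ n) : 2 * (Nat.log 2 n) ^ c + 6 * 0 + 1 ≤ (Nat.log 2 n) ^ (c + 1) := by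
  have hL : 3 ≤ Nat.log 2 n := three_le_log hn
  have h1 : 1 ≤ (Nat.log 2 n) ^ c := Nat.one_le_pow _ _ (by omega)
  rw [pow_succ]
  nlinarith

/-- **THE COLLAPSE `M → T`** (critic 69v16 as a theorem): g16's generic piece `ManyLocusLoss3` implies — hence is
equivalent to — the target.  NEGATIVE KNOWLEDGE: a dichotomy by a syntactic smallness property of `dev P x` that
row padding can destroy has an ABSORBING generic side. -/
theorem polyLossOddU3_of_manyLocusLoss3 (hM : ManyLocusLoss3) : ExactnessDial.PolyLossOddU3 := by
  obtain ⟨C, hC⟩ := hM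
  refine ⟨C, fun c => ?_⟩
  obtain ⟨n₁, hn₁⟩ := hC c c c
  obtain ⟨n₂, hn₂⟩ := hC c c (c + 1)
  refine ⟨max (max n₁ n₂) (4 * (c * (c + 1)) + 8), fun n hn P hP => ?_⟩
  have hn1 : n₁ ≤ n := le_trans (le_trans (le_max_left _ _) (le_max_left _ _)) hn
  have hn2 : n₂ ≤ n := le_trans (le_trans (le_max_right _ _) (le_max_left _ _)) hn
  have hbig : 4 * (c * (c + 1)) + 8 ≤ n := le_trans (le_max_right _ _) hn
  have h8 : 8 ≤ n := by omega
  by_cases hF : FewLocus c c P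
  · -- `P` few-locus ⟹ `pad P comb` is not; `M` bounds the padded strategy's win set, which is `P`'s.
    have hF' : ¬ FewLocus c c (pad P comb) := fun h => not_fewLocus_both h8 hbig P hF h
    have hdeg : ∀ i, pad P comb i ∈ lowDeg (ZMod 3) n ((Nat.log 2 n) ^ (c + 1)) := fun i =>
      lowDeg_mono (deg_pad_comb n c h8) (pad_mem hP (comb_mem 0) i)
    have h := hn₂ n hn2 (pad P comb) hdeg hF'
    rwa [winset_pad] at h
  · exact hn₁ n hn1 P hP hF

/-- **`M ⟺ T`.** -/
theorem manyLocusLoss3_iff : ManyLocusLoss3 ↔ ExactnessDial.PolyLossOddU3 :=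
  ⟨polyLossOddU3_of_manyLocusLoss3, manyLocusLoss3_of_polyLossOddU3⟩


/-! ## §4  Gauge sums; the STABILIZER-FEW class and its invariance under row padding (the ROW-PADDING TEST) -/

/-- the `𝔽₂`-SUM of two gauges (bits XOR), as `0/1`-valued cube functions. -/
def gsum (s t : Fin N → CubeFn (ZMod 3) N) (i : Fin N) : CubeFn (ZMod 3) N := xorP (selP (s i)) (selP (t i))

/-- StabilizerDialGauge helper `bitP_gsum` (decomp-qadv land package; see the module docstring). -/
theorem bitP_gsum (s t : Fin N → CubeFn (ZMod 3) N) (i : Fin N) (x : Fin N → Bool) :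
    bitP (gsum s t i) x = xor (bitP (s i) x) (bitP (t i) x) := by
  show decide (gsum s t i x = 1) = _
  rw [show gsum s t i x = if xor (bitP (s i) x) (bitP (t i) x) then 1 else 0 from
    xorP_apply_bool _ _ x _ _ (selP_apply_bit _ x) (selP_apply_bit _ x)]
  generalize xor (bitP (s i) x) (bitP (t i) x) = q
  cases q <;> decide

/-- StabilizerDialGauge helper `gsum_mem` (decomp-qadv land package; see the module docstring). -/
theorem gsum_mem {E E' : ℕ} {s t : Fin N → CubeFn (ZMod 3) N} (hs : ∀ i, s i ∈ lowDeg (ZMod 3) N E)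
    (ht : ∀ i, t i ∈ lowDeg (ZMod 3) N E') (i : Fin N) : gsum s t i ∈ lowDeg (ZMod 3) N (2 * E + 2 * E') :=
  lowDeg_mono (by omega) (xorP_mem (selP_mem (hs i)) (selP_mem (ht i)))

/-- the row mask is ADDITIVE in the gauge (`M(x)` is linear). -/
theorem rowMask_gsum (s t : Fin N → CubeFn (ZMod 3) N) (x : Fin N → Bool) (j : Fin N) :
    rowMask (gsum s t) x j = xor (rowMask s x j) (rowMask t x j) := by
  unfold rowMask
  rw [show bits (gsum s t) x = fun i => xor (bits s x i) (bits t x i) from funext fun i => bitP_gsum s t i x]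
  exact rowVec_xor x _ _ j

/-- the row mask depends on the gauge only through its bits. -/
theorem rowMask_congr {s t : Fin N → CubeFn (ZMod 3) N} (h : ∀ i x, bitP (s i) x = bitP (t i) x)
    (x : Fin N → Bool) (j : Fin N) : rowMask s x j = rowMask t x j := by
  unfold rowMask
  rw [show bits s x = bits t x from funext fun i => h i x]

/-- StabilizerDialGauge helper `outB_pad_congr` (decomp-qadv land package; see the module docstring). -/
theorem outB_pad_congr {s t : Fin N → CubeFn (ZMod 3) N} (h : ∀ i x, bitP (s i) x = bitP (t i) x)
    (P : Fin N → CubeFn (ZMod 3) N) (x : Fin N → Bool) : outB (pad P s) x = outB (pad P t) x := by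
  rw [outB_pad, outB_pad]
  funext j
  rw [rowMask_congr h]

/-- PADDING TWICE = padding once by the gauge sum (at the level of answers). -/
theorem outB_pad_pad (P s t : Fin N → CubeFn (ZMod 3) N) (x : Fin N → Bool) :
    outB (pad (pad P s) t) x = outB (pad P (gsum s t)) x := by
  rw [outB_pad, outB_pad, outB_pad]
  funext j
  rw [rowMask_gsum, Bool.xor_assoc]

/-- padding by the ZERO gauge changes no answer. -/
theorem outB_pad_zero (P : Fin N → CubeFn (ZMod 3) N) (x : Fin N → Bool) :
    outB (pad P (fun _ => 0)) x = outB P x := by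
  rw [outB_pad]
  funext j
  have hb : bits (fun _ : Fin N => (0 : CubeFn (ZMod 3) N)) x = fun _ => false := by
    funext i; show decide ((0 : CubeFn (ZMod 3) N) x = 1) = false; simp
  rw [show rowMask (fun _ : Fin N => (0 : CubeFn (ZMod 3) N)) x j = false by
    unfold rowMask; rw [hb]; exact rowVec_false x j, Bool.xor_false]

/-- **STABILIZER-FEW at `(m, r, e)`**: some gauge of degree `≤ (log₂ N)^e` turns `P` into an `(m, r)`-few-locus
strategy — the SATURATION of g16's few-locus class under the stabilizer gauge (degree-graded). -/
def StabFew (m r e : ℕ) (P : Fin N → CubeFn (ZMod 3) N) : Prop :=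
  ∃ s : Fin N → CubeFn (ZMod 3) N, (∀ i, s i ∈ lowDeg (ZMod 3) N ((Nat.log 2 N) ^ e)) ∧ FewLocus m r (pad P s)

/-- few-locus ⟹ stabilizer-few (zero gauge). -/
theorem stabFew_of_fewLocus {m r : ℕ} (e : ℕ) {P : Fin N → CubeFn (ZMod 3) N} (h : FewLocus m r P) :
    StabFew m r e P :=
  ⟨fun _ => 0, fun _ => Submodule.zero_mem _, (fewLocus_congr (outB_pad_zero P)).mpr h⟩

/-- StabilizerDialGauge helper `stabFew_mono` (decomp-qadv land package; see the module docstring). -/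
theorem stabFew_mono {m r e e' : ℕ} (hN : 2 ≤ N) (he : e ≤ e') {P : Fin N → CubeFn (ZMod 3) N}
    (h : StabFew m r e P) : StabFew m r e' P := by
  obtain ⟨s, hs, hF⟩ := h
  have hL : 1 ≤ Nat.log 2 N := Nat.le_log_of_pow_le (by norm_num) (by norm_num; omega)
  exact ⟨s, fun i => lowDeg_mono (Nat.pow_le_pow_right hL he) (hs i), hF⟩

/-- StabilizerDialGauge helper `four_le_log` (decomp-qadv land package; see the module docstring). -/
theorem four_le_log (hN : 16 ≤ N) : 4 ≤ Nat.log 2 N :=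
  Nat.le_log_of_pow_le (by norm_num) (by norm_num; omega)

/-- StabilizerDialGauge helper `deg_gsum` (decomp-qadv land package; see the module docstring). -/
theorem deg_gsum (hN : 16 ≤ N) {e₀ e : ℕ} (h : e₀ ≤ e) :
    2 * (Nat.log 2 N) ^ e₀ + 2 * (Nat.log 2 N) ^ e ≤ (Nat.log 2 N) ^ (e + 1) := by
  have hL := four_le_log hN
  have h1 : (Nat.log 2 N) ^ e₀ ≤ (Nat.log 2 N) ^ e := Nat.pow_le_pow_right (by omega) h
  have h2 : (Nat.log 2 N) ^ e * 4 ≤ (Nat.log 2 N) ^ e * Nat.log 2 N := Nat.mul_le_mul_left _ hL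
  rw [pow_succ]
  omega

/-- **ROW-PADDING TEST, direction 1**: if a PAD of `P` (by any gauge of degree `≤ (log₂ N)^{e₀}`, `e₀ ≤ e`) is
stabilizer-few at level `e`, then `P` itself is stabilizer-few at level `e + 1` (undo the pad inside the gauge). -/
theorem stabFew_of_stabFew_pad (hN : 16 ≤ N) {m r e₀ e : ℕ} (he : e₀ ≤ e) {P s₀ : Fin N → CubeFn (ZMod 3) N}
    (hs₀ : ∀ i, s₀ i ∈ lowDeg (ZMod 3) N ((Nat.log 2 N) ^ e₀)) (h : StabFew m r e (pad P s₀)) :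
    StabFew m r (e + 1) P := by
  obtain ⟨s, hs, hF⟩ := h
  exact ⟨gsum s₀ s, fun i => lowDeg_mono (deg_gsum hN he) (gsum_mem hs₀ hs i),
    (fewLocus_congr (fun x => outB_pad_pad P s₀ s x)).mp hF⟩

/-- **ROW-PADDING TEST, direction 2**: padding a stabilizer-few strategy keeps it stabilizer-few (one notch up). -/
theorem stabFew_pad_of_stabFew (hN : 16 ≤ N) {m r e₀ e : ℕ} (he : e₀ ≤ e) {P s₀ : Fin N → CubeFn (ZMod 3) N}
    (hs₀ : ∀ i, s₀ i ∈ lowDeg (ZMod 3) N ((Nat.log 2 N) ^ e₀)) (h : StabFew m r e P) :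
    StabFew m r (e + 1) (pad P s₀) := by
  obtain ⟨s, hs, hF⟩ := h
  refine ⟨gsum s₀ s, fun i => lowDeg_mono (deg_gsum hN he) (gsum_mem hs₀ hs i), ?_⟩
  have e1 : ∀ x, outB (pad (pad P s₀) (gsum s₀ s)) x = outB (pad P s) x := fun x => by
    rw [outB_pad_pad]
    exact outB_pad_congr (fun i x => by
      rw [bitP_gsum, bitP_gsum, ← Bool.xor_assoc, Bool.xor_self, Bool.false_xor]) P x
  exact (fewLocus_congr e1).mpr hF

/-- hence GENERICITY (= not stabilizer-few) passes from a strategy to each of its pads and back, with one notch of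
slack: the generic class is NOT absorbing under row padding — the reduction that collapsed g16's `M` (§3) maps the
generic class into itself. -/
theorem generic_pad_of_generic (hN : 16 ≤ N) {m r e₀ e : ℕ} (he : e₀ ≤ e) {P s₀ : Fin N → CubeFn (ZMod 3) N}
    (hs₀ : ∀ i, s₀ i ∈ lowDeg (ZMod 3) N ((Nat.log 2 N) ^ e₀)) (h : ¬ StabFew m r (e + 1) P) :
    ¬ StabFew m r e (pad P s₀) :=
  fun h' => h (stabFew_of_stabFew_pad hN he hs₀ h')

/-- StabilizerDialGauge helper `generic_of_generic_pad` (decomp-qadv land package; see the module docstring). -/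
theorem generic_of_generic_pad (hN : 16 ≤ N) {m r e₀ e : ℕ} (he : e₀ ≤ e) {P s₀ : Fin N → CubeFn (ZMod 3) N}
    (hs₀ : ∀ i, s₀ i ∈ lowDeg (ZMod 3) N ((Nat.log 2 N) ^ e₀)) (h : ¬ StabFew m r (e + 1) (pad P s₀)) :
    ¬ StabFew m r e P :=
  fun h' => h (stabFew_pad_of_stabFew hN he hs₀ h')

/-! ## §5  THE NODE: `T ⟺ U ∧ G` — `U = FewLocusLoss3` (tree, g16), `G = StabGenericLoss3` (the GAUGE-SATURATED complement) -/

/-- **PIECE G (crux) `StabGenericLoss3` — `T` RESTRICTED TO THE GENERIC CLASS**: for every `m, r, c`, eventually every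
degree-`(log₂ n)^c` strategy that NO gauge of degree `(log₂ n)^{c+1}` turns into an `(m, r)`-few-locus strategy loses
a polynomial fraction of the odd class.  The gauge budget sits one notch ABOVE the strategy's own degree, so that a
pad's genericity is inherited by the unpadded strategy (§4): the class is padding-closed by construction. -/
def StabGenericLoss3 : Prop :=
  ∃ C : ℕ, ∀ m r c : ℕ, ∃ n₀ : ℕ, ∀ n ≥ n₀, ∀ P : Fin n → CubeFn (ZMod 3) n,
    (∀ i, P i ∈ lowDeg (ZMod 3) n ((Nat.log 2 n) ^ c)) → ¬ StabFew m r (c + 1) P →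
      ((univ.filter fun x : Fin n → Bool => OddZeros x ∧ Rel x (fun i => decide (P i x = 1))).card : ℝ) ≤
        (1 - 1 / (n : ℝ) ^ C) * (2 : ℝ) ^ (n - 1)

/-- `T → G` (restriction). -/
theorem stabGenericLoss3_of_polyLossOddU3 (h : ExactnessDial.PolyLossOddU3) : StabGenericLoss3 := by
  obtain ⟨C, hC⟩ := h
  refine ⟨C, fun _ _ c => ?_⟩
  obtain ⟨n₀, hn₀⟩ := hC c
  exact ⟨n₀, fun n hn P hP _ => hn₀ n hn P hP⟩

/-- StabilizerDialGauge helper `nine_le_log` (decomp-qadv land package; see the module docstring). -/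
theorem nine_le_log (hN : 512 ≤ N) : 9 ≤ Nat.log 2 N :=
  Nat.le_log_of_pow_le (by norm_num) (by norm_num; omega)

/-- StabilizerDialGauge helper `deg_pad_stab` (decomp-qadv land package; see the module docstring). -/
theorem deg_pad_stab (n c : ℕ) (hn : 512 ≤ n) :
    2 * (Nat.log 2 n) ^ c + 6 * (Nat.log 2 n) ^ (c + 1) + 1 ≤ (Nat.log 2 n) ^ (c + 2) := by
  have hL := nine_le_log hn
  have h1 : 1 ≤ (Nat.log 2 n) ^ c := Nat.one_le_pow _ _ (by omega)
  have h2 : (Nat.log 2 n) ^ c ≤ (Nat.log 2 n) ^ (c + 1) := Nat.pow_le_pow_right (by omega) (by omega)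
  rw [show c + 2 = (c + 1) + 1 by omega, pow_succ _ (c + 1)]
  nlinarith

/-- **dichotomy `U ∧ G → T`**: at degree budget `c` split on `StabFew c c (c+1) P`; the structured branch is
discharged by `U` applied to the PADDED strategy (same win set, degree `≤ (log₂ n)^{c+2}`), the generic branch by `G`. -/
theorem polyLossOddU3_of_stab (hU : FewLocusLoss3) (hG : StabGenericLoss3) : ExactnessDial.PolyLossOddU3 := by
  obtain ⟨CU, hU⟩ := hU
  obtain ⟨CG, hG⟩ := hG
  refine ⟨max CU CG, fun c => ?_⟩
  obtain ⟨n₁, hn₁⟩ := hU c c (c + 2)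
  obtain ⟨n₂, hn₂⟩ := hG c c c
  refine ⟨max (max n₁ n₂) 512, fun n hn P hP => ?_⟩
  have hn1 : n₁ ≤ n := le_trans (le_trans (le_max_left _ _) (le_max_left _ _)) hn
  have hn2 : n₂ ≤ n := le_trans (le_trans (le_max_right _ _) (le_max_left _ _)) hn
  have h512 : 512 ≤ n := le_trans (le_max_right _ _) hn
  have h1 : 1 ≤ n := by omega
  have hP0 : (0 : ℝ) ≤ (2 : ℝ) ^ (n - 1) := by positivity
  by_cases hS : StabFew c c (c + 1) P
  · obtain ⟨s, hs, hF⟩ := hS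
    have hdeg : ∀ i, pad P s i ∈ lowDeg (ZMod 3) n ((Nat.log 2 n) ^ (c + 2)) := fun i =>
      lowDeg_mono (deg_pad_stab n c h512) (pad_mem hP hs i)
    have h := hn₁ n hn1 (pad P s) hdeg hF
    rw [winset_pad] at h
    exact loss_shape_mono h1 (le_max_left CU CG) _ _ hP0 h
  · exact loss_shape_mono h1 (le_max_right CU CG) _ _ hP0 (hn₂ n hn2 P hP hS)

/-- **NODE EQUATION**: `T ⟺ U ∧ G`. -/
theorem node_iff : ExactnessDial.PolyLossOddU3 ↔ FewLocusLoss3 ∧ StabGenericLoss3 :=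
  ⟨fun h => ⟨fewLocusLoss3_of_polyLossOddU3 h, stabGenericLoss3_of_polyLossOddU3 h⟩,
    fun h => polyLossOddU3_of_stab h.1 h.2⟩

/-- **`closes`**: both pieces are consumed and the leaf `AdviceFreeQNC0Three` is reached BY NAME through the tree's
`HolonomyDial.closes_T` (with the cone's standing outer lift `DPLift3`, item 26124). -/
theorem closes (hU : FewLocusLoss3) (hG : StabGenericLoss3) (hD : ExactnessDial.DPLift3) : AdviceFreeQNC0Three :=
  closes_T (polyLossOddU3_of_stab hU hG) hD

/-! ## §6  The saturation is REAL (structured ⊋ few-locus, and it swallows g16's many-locus witnesses); the generic class -/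

/-- the canonical strategy is stabilizer-few at every level. -/
theorem stabFew_tPoly (m r e : ℕ) : StabFew m r e (fun i : Fin N => tPoly i) :=
  stabFew_of_fewLocus e (fewLocus_tPoly m r)

/-- a PAD of a few-locus strategy by ANY polylog gauge is stabilizer-few — in particular critic 69v16's witnesses
(`{0}`-bets padded by far rows: many-locus, value `2/3`) all sit on the STRUCTURED side of the g17 cut. -/
theorem stabFew_pad_of_fewLocus (hN : 16 ≤ N) {m r e : ℕ} {P s₀ : Fin N → CubeFn (ZMod 3) N}
    (hs₀ : ∀ i, s₀ i ∈ lowDeg (ZMod 3) N ((Nat.log 2 N) ^ e)) (h : FewLocus m r P) :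
    StabFew m r (e + 1) (pad P s₀) :=
  stabFew_pad_of_stabFew hN le_rfl hs₀ (stabFew_of_fewLocus e h)

/-- the comb-padded canonical strategy is MANY-locus (g16's `M`-side) … -/
theorem not_fewLocus_pad_tPoly_comb {m r : ℕ} (hN8 : 8 ≤ N) (hN : 4 * (m * (r + 1)) + 8 ≤ N) :
    ¬ FewLocus m r (pad (fun i : Fin N => tPoly i) comb) :=
  fun h => not_fewLocus_both hN8 hN _ (fewLocus_tPoly m r) h

/-- … yet STABILIZER-FEW at every level `≥ 1`: the g17 structured class strictly contains g16's `U`-class and meets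
g16's `M`-class. -/
theorem stabFew_pad_tPoly_comb (hN : 16 ≤ N) (m r e : ℕ) : StabFew m r (e + 1) (pad (fun i : Fin N => tPoly i) comb) :=
  stabFew_pad_of_fewLocus hN (fun i => comb_mem _ i) (fewLocus_tPoly m r)

/-- **GENERIC-CLASS WITNESS TARGET `AcGeneric3`** (UNDECIDED; law target, not an item): the anti-canonical strategy
`1 - t(x)` (degree 2, deviation set = the whole ring on every input, `LocusDial.dev_acStrat`) is NOT polylog-gauge-
localisable.  A localising gauge would solve `M(x) s(x) = 𝟙` off `m` windows on most inputs, i.e. produce long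
KERNEL-TYPE stretches (transfer-matrix products of length `≫ (log₂ n)^e`) in degree `(log₂ n)^e` — conjecturally
impossible (Smolensky-type: the stretch encodes prefix parities); a proof certifies the generic class NON-EMPTY among
low-degree strategies, i.e. that the g17 cut does not secretly put everything on the `U`-side. -/
def AcGeneric3 : Prop :=
  ∀ m r e : ℕ, ∃ n₀ : ℕ, ∀ n ≥ n₀, ¬ StabFew m r e (fun i : Fin n => acStrat i)

/-! ## §7  Asides (Prop definitions + the easy implication; UNDECIDED, not items) -/

/-- **STRONG FORM `G⁺ = StabGenericConst3`** (the STABILIZER XOR LAW, constant-loss form): for every `m` there is a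
constant `θ_m < 1` such that every generic-at-`(m, r)` polylog strategy wins at most a `θ_m`-fraction of the odd class
(eventually).  Heuristic: a gauge-irreducible bet at `> m` far loci is an XOR of `> m` nearly independent kernel-phase
coins that low degree cannot correlate; `θ` is NOT hand-picked (`∃ θ < 1`, typing rule (iv)). -/
def StabGenericConst3 : Prop :=
  ∀ m : ℕ, ∃ θ : ℝ, θ < 1 ∧ ∀ r c : ℕ, ∃ n₀ : ℕ, ∀ n ≥ n₀, ∀ P : Fin n → CubeFn (ZMod 3) n,
    (∀ i, P i ∈ lowDeg (ZMod 3) n ((Nat.log 2 n) ^ c)) → ¬ StabFew m r (c + 1) P →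
      ((univ.filter fun x : Fin n → Bool => OddZeros x ∧ Rel x (fun i => decide (P i x = 1))).card : ℝ) ≤
        θ * (2 : ℝ) ^ (n - 1)

/-- `G⁺ → G` (with `C = 1`). -/
theorem stabGenericLoss3_of_const (h : StabGenericConst3) : StabGenericLoss3 := by
  refine ⟨1, fun m r c => ?_⟩
  obtain ⟨θ, hθ, hθ'⟩ := h m
  obtain ⟨n₀, hn₀⟩ := hθ' r c
  obtain ⟨K, hK⟩ := exists_nat_gt (1 / (1 - θ))
  refine ⟨max (max n₀ K) 1, fun n hn P hP hG => ?_⟩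
  have hn0 : n₀ ≤ n := le_trans (le_trans (le_max_left _ _) (le_max_left _ _)) hn
  have hnK : K ≤ n := le_trans (le_trans (le_max_right _ _) (le_max_left _ _)) hn
  have hn1 : 1 ≤ n := le_trans (le_max_right _ _) hn
  have hb := hn₀ n hn0 P hP hG
  have hpos : (0 : ℝ) < 1 - θ := by linarith
  have hnr : 1 / (1 - θ) < (n : ℝ) := lt_of_lt_of_le hK (by exact_mod_cast hnK)
  have hnpos : (0 : ℝ) < n := by exact_mod_cast (show 0 < n by omega)
  have hθn : θ ≤ 1 - 1 / (n : ℝ) ^ 1 := by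
    rw [pow_one]
    have : 1 / (n : ℝ) < 1 - θ := by
      rw [div_lt_iff₀ hnpos]
      have := (div_lt_iff₀ hpos).mp hnr
      linarith
    linarith
  have hP0 : (0 : ℝ) ≤ (2 : ℝ) ^ (n - 1) := by positivity
  exact hb.trans (mul_le_mul_of_nonneg_right hθn hP0)

end Summit.QuantumAdvantage.QuantumAdvantage.Theorems.StabilizerDial

end
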